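import Literature.AnabelianGeometry.EtaleTheta.SettingModel
import Literature.AnabelianGeometry.EtaleTheta.Discharge.Sec1DeltaThetaZHat
import Mathlib.Topology.Baire.Lemmas
import Mathlib.Topology.Baire.LocallyCompactRegular
import HarnessLib

/-!
# A model of the [EtTh] §1 root, part G: what the model decides — `Ẑ` is uncountable, the model's `Δ_Θ`
# is countable, and the closedness binder `hYcl` is NOT a consequence of the root interface

Mochizuki, *The étale theta function …*, Publ. RIMS **45** (2009) [EtTh], §1, PRIMS PDF p. 12
[cite: MochizukiEtTh2009, §1 p.12]: "`1 → Δ_Θ → (Δ^tp_Y)^Θ → (Δ^tp_Y)^ell → 1` … a natural exact sequence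
of abelian profinite groups", "`(Ẑ(1) ≅) Δ_Θ`". Layer L2 of the abc-iut cell, seat abc-iut-L2-t1 (root
owner); proof-only sequel of the model files A–E.

In the cell the sentence "(Δ^tp_Y)^Θ is profinite" is carried as the explicit binder
`hYcl : closure(image of Δ^tp_Y in Π_X) ≤ image ⊔ [[Δ_X,Δ_X],Δ_X]⁻` (plan/GAP-LEDGER.md G-w4d021-2), under
which abc-iut-L2-d1 proved `Δ_Θ ≃* Ẑ` (`IsEtThOrigin.nonempty_deltaTheta_mulEquiv_zHat`). THIS FILE
proves, in the kernel, that `hYcl` is INDEPENDENT of the root interface plus its guard: the model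
`ThetaSetting.model p` (which satisfies `IsEtThOrigin`) violates it. Mechanism: the model's `Δ_Θ` is a
subquotient of the countable group `F₂` (`countable_deltaTheta`), whereas `Ẑ` is uncountable
(`not_countable_zHat`: an infinite compact Hausdorff group is uncountable, by Baire); so `Δ_Θ(model) ≄ Ẑ`,
hence `¬ hYcl(model)` (`not_hYcl_model`) and `hYcl_not_derivable :
¬ ∀ D : ThetaSetting p, D.IsEtThOrigin → hYcl D`. READING: this says nothing against print (there
`(Δ^tp_Y)^Θ` IS profinite); it says the typed root `Setting.lean` v3 does not record that sentence, so the
binder (or a future root field) is genuinely needed — numbers, not opinions, for the planners. No Prop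
facts, no instances; nothing of [EtTh] asserted; no side taken on [IUTchIII] Cor. 3.12.
-/

noncomputable section

namespace Literature.AnabelianGeometry.EtaleTheta.SettingModel

open Literature.AnabelianGeometry.SemiGraphs
open CategoryTheory

/-! ### `Ẑ` is infinite and uncountable -/

/-- `ℤ` is residually finite: `n ≠ 0` survives in `ℤ/(|n|+1)`. [folklore] -/
private theorem residuallyFinite_multiplicative_int : Group.ResiduallyFinite (Multiplicative ℤ) := by
  refine Group.residuallyFinite_of_forall_exists_finite_monoidHom fun g hg => ?_
  set n : ℤ := Multiplicative.toAdd g with hn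
  have hn0 : n ≠ 0 := fun h => hg (by rw [← ofAdd_toAdd g, ← hn, h, ofAdd_zero])
  refine ⟨Multiplicative (ZMod (n.natAbs + 1)), inferInstance, inferInstance,
    AddMonoidHom.toMultiplicative (Int.castAddHom (ZMod (n.natAbs + 1))), ?_⟩
  intro h1
  have h2 : ((n : ℤ) : ZMod (n.natAbs + 1)) = 0 := by
    have := congrArg Multiplicative.toAdd h1
    simpa using this
  rw [ZMod.intCast_zmod_eq_zero_iff_dvd] at h2
  exact hn0 (Int.eq_zero_of_dvd_of_natAbs_lt_natAbs h2 (by omega))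

/-- `Ẑ` is infinite (`ℤ ↪ Ẑ`). [cite: MochizukiEtTh2009, §1 p.12] -/
theorem infinite_zHat : Infinite ZHat := by
  haveI := residuallyFinite_multiplicative_int
  exact Infinite.of_injective _
    ((ProfiniteGrp.ProfiniteCompletion.etaFn_injective_iff_residuallyFinite
      (GrpCat.of (Multiplicative ℤ))).mpr inferInstance)

/-- An infinite compact Hausdorff topological group is uncountable (Baire: a countable compact Hausdorff
space has an isolated point, a group with an isolated point is discrete, compact discrete is finite).
[folklore] -/
private theorem not_countable_of_compactSpace (G : Type*) [Group G] [TopologicalSpace G]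
    [IsTopologicalGroup G] [CompactSpace G] [T2Space G] [Infinite G] : ¬ Countable G := by
  intro hc
  obtain ⟨x, hx⟩ := nonempty_interior_of_iUnion_of_closed (X := G) (f := fun x : G => ({x} : Set G))
    (fun _ => isClosed_singleton) (by ext y; simp)
  have hopen : IsOpen ({x} : Set G) := by
    obtain ⟨z, hz⟩ := hx
    have hz' : z = x := Set.mem_singleton_iff.mp (interior_subset hz)
    subst hz'
    have hsub : interior ({z} : Set G) = {z} :=
      Set.Subset.antisymm interior_subset (Set.singleton_subset_iff.mpr hz)
    rw [← hsub]
    exact isOpen_interior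
  have h1 : IsOpen ({1} : Set G) := by
    have := (Homeomorph.mulLeft x⁻¹).isOpenMap _ hopen
    simpa [Set.image_singleton] using this
  haveI : DiscreteTopology G := discreteTopology_of_isOpen_singleton_one h1
  haveI : Finite G := finite_of_compact_of_discrete
  exact not_finite G

/-- **`Ẑ` is uncountable.** [cite: MochizukiEtTh2009, §1 p.12] -/
theorem not_countable_zHat : ¬ Countable ZHat := by
  haveI := infinite_zHat
  exact not_countable_of_compactSpace ZHat

/-! ### The model's `Δ_Θ` is countable -/

/-- `F₂` is countable. [folklore] -/
private theorem countable_F₂ : Countable F₂ :=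
  Function.Surjective.countable (f := (FreeGroup.mk : List (Fin 2 × Bool) → F₂))
    fun x => ⟨x.toWord, FreeGroup.mk_toWord⟩

variable (p : ℕ) [Fact p.Prime]

/-- `KEll = toHat⁻¹([Δ_X,Δ_X]⁻) ⊆ F₂ × 1` is countable. [cite: MochizukiEtTh2009, §1 p.12] -/
theorem countable_KEll : Countable (KEll p) := by
  haveI : Countable Del := countable_F₂
  have hinj : Function.Injective (fun a : KEll p => (a.1.1 : Del)) := by
    intro a b h
    apply Subtype.ext
    have ha := snd_eq_one_of_mem_deltaHat p (toHat_mem_deltaHat_of_mem_KEll p a.2)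
    have hb := snd_eq_one_of_mem_deltaHat p (toHat_mem_deltaHat_of_mem_KEll p b.2)
    have ha' : a.1.2 = 1 := etaGam_injective p (by rw [map_one]; exact ha)
    have hb' : b.1.2 = 1 := etaGam_injective p (by rw [map_one]; exact hb)
    exact Prod.ext h (ha'.trans hb'.symm)
  exact hinj.countable

/-- **The model's `Δ_Θ` is countable** (a subquotient of `F₂`: the centre of the DISCRETE Heisenberg group
up to the closure bookkeeping). [cite: MochizukiEtTh2009, §1 p.12] -/
theorem countable_deltaTheta : Countable (ThetaSetting.model p).DeltaTheta := by
  haveI := countable_KEll p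
  refine Function.Surjective.countable
    (f := fun a : KEll p =>
      (⟨(a.1 : GTheta p), (mk_mem_ker_thetaToEllM_iff p a.1).mpr a.2⟩ : (ThetaSetting.model p).DeltaTheta))
    fun x => ?_
  obtain ⟨a, ha⟩ := QuotientGroup.mk_surjective x.1
  have hmem : a ∈ KEll p := (mk_mem_ker_thetaToEllM_iff p a).mp (by rw [ha]; exact x.2)
  exact ⟨⟨a, hmem⟩, Subtype.ext ha⟩

/-- Hence the model's `Δ_Θ` is NOT isomorphic to `Ẑ`. [cite: MochizukiEtTh2009, §1 p.12] -/
theorem not_nonempty_deltaTheta_mulEquiv_zHat :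
    ¬ Nonempty (↥(ThetaSetting.model p).DeltaTheta ≃* ZHat) := by
  rintro ⟨e⟩
  haveI := countable_deltaTheta p
  exact not_countable_zHat (Countable.of_equiv _ e.toEquiv)

/-! ### Independence of `hYcl` -/

/-- **The closedness binder `hYcl` FAILS in the model** (it satisfies `IsEtThOrigin`, and `hYcl` would force
`Δ_Θ ≃* Ẑ` by abc-iut-L2-d1's `IsEtThOrigin.nonempty_deltaTheta_mulEquiv_zHat`).
[cite: MochizukiEtTh2009, §1 p.12] -/
theorem not_hYcl_model :
    ¬ (((ThetaSetting.model p).DtpY.map (ThetaSetting.model p).toHat.toMonoidHom).topologicalClosure ≤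
        (ThetaSetting.model p).DtpY.map (ThetaSetting.model p).toHat.toMonoidHom ⊔
          (⁅⁅(ThetaSetting.model p).DeltaHat, (ThetaSetting.model p).DeltaHat⁆,
            (ThetaSetting.model p).DeltaHat⁆).topologicalClosure) :=
  fun h => not_nonempty_deltaTheta_mulEquiv_zHat p
    (ThetaSetting.IsEtThOrigin.nonempty_deltaTheta_mulEquiv_zHat (ThetaSetting.model_isEtThOrigin p) h)

/-- **`hYcl` is not derivable from the root interface and its guard**: the GAP-LEDGER binder G-w4d021-2
("the image of `Δ^tp_Y` in `Δ^Θ_X` is closed") is independent of `ThetaSetting p` + `IsEtThOrigin` — a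
kernel-checked answer for the planners (the sentence must stay a binder or become a root field).
[cite: MochizukiEtTh2009, §1 p.12] -/
theorem hYcl_not_derivable :
    ¬ ∀ D : ThetaSetting p, D.IsEtThOrigin →
      (D.DtpY.map D.toHat.toMonoidHom).topologicalClosure ≤
        D.DtpY.map D.toHat.toMonoidHom ⊔ (⁅⁅D.DeltaHat, D.DeltaHat⁆, D.DeltaHat⁆).topologicalClosure :=
  fun h => not_hYcl_model p (h _ (ThetaSetting.model_isEtThOrigin p))

end Literature.AnabelianGeometry.EtaleTheta.SettingModel

end
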